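import Summits.CriticalPhenomena.PercolationContinuityZ3.Theorems.Transplant.SkelPhiParaRunFrame
import Summits.CriticalPhenomena.PercolationContinuityZ3.Theorems.Transplant.SkelPhiRootBridgeGeom
import HarnessLib

/-!
# N2 (frames-only node `SamePDropOfSkeletonFrm₁`, OPEN), (R) column, (R-38): **ROOT-FRAME CLEARANCE FROM RUN-FRAME BOUNDS** — the two conversion
# lemmas behind the y′-corridor's two-dimensional seed clearance `hclear₃` (`NegB.rootLegAt_frmQ3D_snd` p356852)

A corridor read through the run frame `runX φ c n h 1` at a landing vertex `c` with exact offset `(X, Y) := φ c − φ t` from the root: (1) along —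
`runX … w 0 = (φ w 0 − φ t 0) − X` is exact, so `x₀ ≤ runX … w 0` and `Rs < x₀ + X` give `Rs < rootFrame φ t 1 w 0`; (2) across — `runX … w 1 =
⌊(n·Δy − h·Δx)/U⌋` (`Δ` relative to `c`, `U = n + |h|`), so `B ≤ runX … w 1`, `|runX … w 0| ≤ Z` and the numeric row `n·(Rs − Y) + |h|·Z < B·U` give
`Rs < rootFrame φ t 1 w 1`.  With p5-g16's region boxes (`kgCorrSchedY_region_run_box/_park₁_box/_park₂_box`, p354714) these turn `hclear₃` into
per-region numeric rows (x-clear for the low regions `k ≤ k₀`, row-clear above).  Cell-free.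
builds on p205010 (kernel theorem, internal audit signed; external expert review pending) — nothing in this file uses p205010; nothing here is a claim
about the open node `SamePDropOfSkeletonFrm₁`.
Lane `prim-bschramm`, seat `prim-bschramm-p3` (gen 16; N2 design owner, (R) column owner); helper file (`--supports stmt-CriticalPhenomena-4575 --as helper`).
[cite: KozmaNitzan2024, §4 Lemma 11 (p. 22)] [cite: MartineauTassion2017, §3.2]
-/

noncomputable section

namespace Summit.CriticalPhenomena.PercolationContinuityZ3.Theorems

namespace Transplant

namespace Skelφ

open Literature.Probability.Percolation Literature.Probability.LatticeModels SimpleGraph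

variable {V : Type} {φ : V → Site 2}

/-- The root frame at sign `1`, coordinate `0`, is the exact along offset. [folklore] -/
theorem rootFrame_one_apply_zero (t w : V) : rootFrame φ t 1 w 0 = φ w 0 - φ t 0 := by
  show (if (0 : Fin 2) = 0 then (1 : ℤ) * (φ w 0 - φ t 0) else φ w 1 - φ t 1) = _
  rw [if_pos rfl, one_mul]

/-- The root frame at sign `1`, coordinate `1`, is the exact across offset. [folklore] -/
theorem rootFrame_one_apply_one (t w : V) : rootFrame φ t 1 w 1 = φ w 1 - φ t 1 := by
  show (if (1 : Fin 2) = 0 then (1 : ℤ) * (φ w 0 - φ t 0) else φ w 1 - φ t 1) = _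
  rw [if_neg (by decide)]

/-- **ALONG CLEARANCE FROM THE RUN FRAME**: `x₀ ≤ runX φ c n h 1 w 0` and `Rs < x₀ + (φ c 0 − φ t 0)` give `Rs < rootFrame φ t 1 w 0`.
[cite: KozmaNitzan2024, §4 Lemma 11 (p. 22)] -/
theorem lt_rootFrame_zero_of_runX (t c : V) (n : ℕ) (h : ℤ) {X x₀ Rs : ℤ} (hX : φ c 0 - φ t 0 = X) {w : V}
    (hx : x₀ ≤ runX φ c n h 1 w 0) (hnum : Rs < x₀ + X) : Rs < rootFrame φ t 1 w 0 := by
  rw [runX_zero, relCoord_apply, one_mul] at hx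
  rw [rootFrame_one_apply_zero]
  linarith

/-- **ACROSS CLEARANCE FROM THE RUN FRAME**: `B ≤ runX φ c n h 1 w 1` (rows), `|runX φ c n h 1 w 0| ≤ Z` (along extent) and the numeric row
`n·(Rs − (φ c 1 − φ t 1)) + |h|·Z < B·U` give `Rs < rootFrame φ t 1 w 1`. [cite: KozmaNitzan2024, §4 Lemma 11 (p. 22)] -/
theorem lt_rootFrame_one_of_runX (t c : V) {n : ℕ} (hn : 1 ≤ n) (h : ℤ) {Y B Z Rs : ℤ} (hY : φ c 1 - φ t 1 = Y) {w : V}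
    (hB : B ≤ runX φ c n h 1 w 1) (hZ : |runX φ c n h 1 w 0| ≤ Z) (hnum : (n : ℤ) * (Rs - Y) + |h| * Z < B * (shearUnit n h : ℤ)) :
    Rs < rootFrame φ t 1 w 1 := by
  have hU : 0 < (shearUnit n h : ℤ) := shearUnit_pos hn h
  rw [runX_one, shearCoord_apply, one_mul] at hB
  rw [runX_zero, relCoord_apply, one_mul] at hZ
  rw [rootFrame_one_apply_one]
  -- the floor bound gives the real bound on the shear sum
  have hs : B * (shearUnit n h : ℤ) ≤ (n : ℤ) * (φ w 1 - φ c 1) - h * (φ w 0 - φ c 0) :=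
    le_trans (mul_le_mul_of_nonneg_right hB hU.le) (Int.ediv_mul_le _ hU.ne')
  -- `|h·Δx| ≤ |h|·Z`
  have hhx : -(h * (φ w 0 - φ c 0)) ≤ |h| * Z := by
    have h1 : -(h * (φ w 0 - φ c 0)) ≤ |h * (φ w 0 - φ c 0)| := neg_le_abs _
    have h2 : |h * (φ w 0 - φ c 0)| = |h| * |φ w 0 - φ c 0| := abs_mul _ _
    have h3 : |h| * |φ w 0 - φ c 0| ≤ |h| * Z := mul_le_mul_of_nonneg_left hZ (abs_nonneg _)
    linarith
  have hn0 : (0 : ℤ) < n := by exact_mod_cast hn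
  -- `n·Δy > n·(Rs − Y)` hence `Δy > Rs − Y`
  have hny : (n : ℤ) * (Rs - Y) < (n : ℤ) * (φ w 1 - φ c 1) := by linarith
  have hΔ : Rs - Y < φ w 1 - φ c 1 := lt_of_mul_lt_mul_left hny hn0.le
  linarith

end Skelφ

end Transplant

end Summit.CriticalPhenomena.PercolationContinuityZ3.Theorems

end
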